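import Summits.AtomisticToContinuum.FouriersLaw.Theses.EmbeddedDrudeMourre
import Summits.AtomisticToContinuum.FouriersLaw.Theorems.FGRGap.Negative.OnsiteReduction
import Summits.AtomisticToContinuum.FouriersLaw.Theorems.FGRGap.Negative.LogCoerciveLine
import Summits.AtomisticToContinuum.FouriersLaw.Theorems.EmbeddedDrudeMourreFGRGapLscB
import Literature.MathematicalPhysics.KineticTheory.PinnedChainResonantFinite
import Literature.Analysis.Calculus.SubmersionNullPreimage

/-!
# FGRGap, line `fold-jet-rigidity`: stub S4a `stub_formLowerSemicontinuous`
# — lower semicontinuity of the phonon Boltzmann form along a.e.-convergent sequences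

Registered stub `stub_formLowerSemicontinuous` of crux `EmbeddedDrudeMourre.FGRGap`
(item stmt-AtomisticToContinuum-12595), proved with exactly the registered signature, GIVEN the
branch structure of the resonant set (the conclusion of the structural stub `stub_branchStructure`,
which is the hypothesis bundle of the statement): a partner map `h` with, off the diagonal,
`resonantSet ω₂ k₁ k₃ = {k₃ mod 2π, h k₁ k₃}`, `Measurable (uncurry h)`, a non-junk resolved Jacobian
and local real-analytic lifts off the equal-velocity curve `{v k₃ = v k₁}`.

Contents (namespace `…FGRGap.FoldJetRigidity.Lsc` for the helpers):
* `finsum_resonant_eq_hterm`: for `2π`-periodic `g` and EVERY `(k₁, k₃)` the resolved energy delta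
  `∑ᶠ_{k₂ resonant} w · (g₁+g₂-g₃-g₄)²` is the single term at `k₂ = h k₁ k₃` (the exchange root
  `k₂ ≡ k₃` has vanishing bracket; on the diagonal every bracket vanishes, on both sides).
* `measurable_collisionWeight_comp`, `measurable_hterm`: joint measurability of the integrand.
* `boltzmannForm_eq_lintegral_prod`: `q g = ∫⁻_{(-π,π]²} ofReal (1/4) * ofReal (w(k₁,h,k₃)·bracket²)`
  (Tonelli) — the form in which Fatou's lemma is applied.
* `stub_formLowerSemicontinuous`: the exceptional set of the a.e.-convergent sequence is null and
  `2πℤ`-invariant on `ℝ`; its pull-backs by `p.1`, `p.2`, `h`, `k₄` are null in `ℝ²` (file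
  `EmbeddedDrudeMourreFGRGapLscB`: the lifts of `h`, `k₄` are submersions off the null equal-velocity
  curve); hence the integrands converge a.e. and Fatou's lemma on the square cell concludes.
-/

noncomputable section

open MeasureTheory Set Real Filter Topology
open scoped ENNReal
open Literature.MathematicalPhysics.KineticTheory.PhononBoltzmann
open Summit.AtomisticToContinuum.FouriersLaw.Theorems.FGRGap

namespace Summit.AtomisticToContinuum.FouriersLaw.Theorems.FGRGap.FoldJetRigidity.Lsc

/-! ## The pointwise two-root reduction -/

/-- The bracket `g k₁ + g k₂ - g k₃ - g (k₁ + k₂ - k₃)` of a `2π`-periodic `g` vanishes at the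
exchange root `k₂ = k₃ - m·2π ≡ k₃`. [folklore] -/
theorem bracket_eq_zero_of_exchange {g : ℝ → ℝ} (hg : Function.Periodic g (2 * π)) (k₁ k₃ : ℝ)
    (m : ℤ) : g k₁ + g (k₃ - m * (2 * π)) - g k₃ - g (k₁ + (k₃ - m * (2 * π)) - k₃) = 0 := by
  rw [hg.sub_int_mul_eq, show k₁ + (k₃ - m * (2 * π)) - k₃ = k₁ - m * (2 * π) by ring,
    hg.sub_int_mul_eq]
  ring

/-- On the diagonal `k₃ = k₁ + m·2π` every bracket of a `2π`-periodic `g` vanishes. [folklore] -/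
theorem bracket_eq_zero_of_diagonal {g : ℝ → ℝ} (hg : Function.Periodic g (2 * π)) (k₁ k₂ : ℝ)
    (m : ℤ) : g k₁ + g k₂ - g (k₁ + m * (2 * π)) - g (k₁ + k₂ - (k₁ + m * (2 * π))) = 0 := by
  rw [(hg.int_mul m) k₁, show k₁ + k₂ - (k₁ + m * (2 * π)) = k₂ - m * (2 * π) by ring,
    hg.sub_int_mul_eq]
  ring

/-- The cell representative `k₃ mod 2π ∈ (-π, π]` differs from `k₃` by an integer multiple of `2π`.
[folklore] -/
theorem toIocMod_eq_sub_int_mul (k₃ : ℝ) :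
    toIocMod Real.two_pi_pos (-π) k₃ = k₃ - toIocDiv Real.two_pi_pos (-π) k₃ * (2 * π) := by
  rw [← self_sub_toIocDiv_zsmul, zsmul_eq_mul]

/-- **Two-root reduction of the resolved energy delta.** If off the diagonal the resonant set is
`{k₃ mod 2π, h k₁ k₃}`, then for every `2π`-periodic `g` and EVERY `(k₁, k₃)` the resolved sum
`∑ᶠ_{k₂ resonant} w(k₁,k₂,k₃) (g k₁ + g k₂ - g k₃ - g (k₁+k₂-k₃))²` is the single term at
`k₂ = h k₁ k₃`: the exchange root carries a vanishing bracket, and on the diagonal both sides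
vanish termwise. [folklore] -/
theorem finsum_resonant_eq_hterm {ω₂ : ℝ} {h : ℝ → ℝ → ℝ}
    (hset : ∀ k₁ k₃ : ℝ, (∀ n : ℤ, k₃ - k₁ ≠ n * (2 * π)) →
      resonantSet ω₂ k₁ k₃ = {toIocMod Real.two_pi_pos (-π) k₃, h k₁ k₃})
    (a b : ℝ) {g : ℝ → ℝ} (hg : Function.Periodic g (2 * π)) (k₁ k₃ : ℝ) :
    ∑ᶠ k₂ ∈ resonantSet ω₂ k₁ k₃,
        collisionWeight ω₂ a b k₁ k₂ k₃ * (g k₁ + g k₂ - g k₃ - g (k₁ + k₂ - k₃)) ^ 2 =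
      collisionWeight ω₂ a b k₁ (h k₁ k₃) k₃ *
        (g k₁ + g (h k₁ k₃) - g k₃ - g (k₁ + h k₁ k₃ - k₃)) ^ 2 := by
  by_cases hdiag : ∃ n : ℤ, k₃ - k₁ = n * (2 * π)
  · obtain ⟨n, hn⟩ := hdiag
    have hk₃ : k₃ = k₁ + n * (2 * π) := by linarith
    have hzero : ∀ k₂, g k₁ + g k₂ - g k₃ - g (k₁ + k₂ - k₃) = 0 := fun k₂ => by
      rw [hk₃]
      exact bracket_eq_zero_of_diagonal hg k₁ k₂ n
    have hL : ∑ᶠ k₂ ∈ resonantSet ω₂ k₁ k₃,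
        collisionWeight ω₂ a b k₁ k₂ k₃ * (g k₁ + g k₂ - g k₃ - g (k₁ + k₂ - k₃)) ^ 2 = 0 := by
      apply finsum_mem_of_eqOn_zero
      intro k₂ _
      simp [hzero k₂]
    rw [hL, hzero (h k₁ k₃)]
    ring
  · push Not at hdiag
    rw [hset k₁ k₃ hdiag]
    have hex : collisionWeight ω₂ a b k₁ (toIocMod Real.two_pi_pos (-π) k₃) k₃ *
        (g k₁ + g (toIocMod Real.two_pi_pos (-π) k₃) - g k₃ -
          g (k₁ + toIocMod Real.two_pi_pos (-π) k₃ - k₃)) ^ 2 = 0 := by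
      have hb : g k₁ + g (toIocMod Real.two_pi_pos (-π) k₃) - g k₃ -
          g (k₁ + toIocMod Real.two_pi_pos (-π) k₃ - k₃) = 0 := by
        rw [toIocMod_eq_sub_int_mul]
        exact bracket_eq_zero_of_exchange hg k₁ k₃ _
      rw [hb]
      ring
    by_cases heq : toIocMod Real.two_pi_pos (-π) k₃ = h k₁ k₃
    · rw [← heq, Set.pair_eq_singleton, finsum_mem_singleton, hex]
    · rw [finsum_mem_pair heq, hex, zero_add]

/-! ## Measurability of the resolved integrand -/

/-- The group velocity `v = sin/ω` is measurable, for every real `ω₂`. [folklore] -/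
theorem measurable_groupVelocity (ω₂ : ℝ) : Measurable (groupVelocity ω₂) := by
  unfold groupVelocity
  exact Real.measurable_sin.div (Negative.LogCoerciveLine.measurable_dispersion ω₂)

/-- The collision kernel density composed with measurable arguments,
`x ↦ w(A x, B x, C x)`, is measurable. [folklore] -/
theorem measurable_collisionWeight_comp {α : Type*} [MeasurableSpace α] (ω₂ a b : ℝ)
    {A B C : α → ℝ} (hA : Measurable A) (hB : Measurable B) (hC : Measurable C) :
    Measurable fun x => collisionWeight ω₂ a b (A x) (B x) (C x) := by
  have hd : Measurable (dispersion ω₂) := Negative.LogCoerciveLine.measurable_dispersion ω₂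
  have hv : Measurable (groupVelocity ω₂) := measurable_groupVelocity ω₂
  have hnum : Measurable fun x => alsPrefactor * vertex a b (A x) (B x) (C x) ^ 2 := by
    unfold vertex
    fun_prop
  have hden : Measurable fun x =>
      (dispersion ω₂ (A x) * dispersion ω₂ (B x) * dispersion ω₂ (C x) *
        dispersion ω₂ (A x + B x - C x)) ^ 2 := by
    fun_prop
  have hjac : Measurable fun x => resonanceJacobian ω₂ (A x) (B x) (C x) := by
    unfold resonanceJacobian
    fun_prop
  unfold collisionWeight
  exact (hnum.div hden).div hjac

/-- The resolved integrand through a jointly measurable partner map,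
`p ↦ w(p.1, h p, p.2) · (g p.1 + g (h p) - g p.2 - g (p.1 + h p - p.2))²`, is measurable for
measurable `g`. [folklore] -/
theorem measurable_hterm {h : ℝ → ℝ → ℝ} (hh : Measurable (Function.uncurry h)) (ω₂ a b : ℝ)
    {g : ℝ → ℝ} (hg : Measurable g) :
    Measurable fun p : ℝ × ℝ => collisionWeight ω₂ a b p.1 (h p.1 p.2) p.2 *
      (g p.1 + g (h p.1 p.2) - g p.2 - g (p.1 + h p.1 p.2 - p.2)) ^ 2 := by
  have hH : Measurable fun p : ℝ × ℝ => h p.1 p.2 := hh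
  have hw : Measurable fun p : ℝ × ℝ => collisionWeight ω₂ a b p.1 (h p.1 p.2) p.2 :=
    measurable_collisionWeight_comp ω₂ a b measurable_fst hH measurable_snd
  have hb : Measurable fun p : ℝ × ℝ =>
      g p.1 + g (h p.1 p.2) - g p.2 - g (p.1 + h p.1 p.2 - p.2) := by
    fun_prop
  exact hw.mul (hb.pow_const 2)

/-! ## The form as one integral over the square cell -/

/-- **The Boltzmann form as one integral over the square cell.** For a partner map `h` with the
two-root property and `Measurable (uncurry h)`, and `2π`-periodic measurable `g`:
`q(g) = ∫⁻_{(k₁,k₃) ∈ (-π,π]²} ofReal (1/4) * ofReal (w(k₁, h, k₃) · bracket²)` (two-root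
reduction pointwise, then Tonelli for the product of the restricted Lebesgue measures). [folklore] -/
theorem boltzmannForm_eq_lintegral_prod {ω₂ : ℝ} {h : ℝ → ℝ → ℝ}
    (hset : ∀ k₁ k₃ : ℝ, (∀ n : ℤ, k₃ - k₁ ≠ n * (2 * π)) →
      resonantSet ω₂ k₁ k₃ = {toIocMod Real.two_pi_pos (-π) k₃, h k₁ k₃})
    (hh : Measurable (Function.uncurry h)) (a b : ℝ) {g : ℝ → ℝ}
    (hg : Function.Periodic g (2 * π)) (hgm : Measurable g) :
    boltzmannForm ω₂ a b g = ∫⁻ p in Ioc (-π) π ×ˢ Ioc (-π) π,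
      ENNReal.ofReal (1 / 4) * ENNReal.ofReal (collisionWeight ω₂ a b p.1 (h p.1 p.2) p.2 *
        (g p.1 + g (h p.1 p.2) - g p.2 - g (p.1 + h p.1 p.2 - p.2)) ^ 2) := by
  have hm := (measurable_hterm hh ω₂ a b hgm).ennreal_ofReal
  unfold boltzmannForm
  rw [lintegral_const_mul _ hm]
  congr 1
  rw [Measure.volume_eq_prod, ← Measure.prod_restrict, lintegral_prod _ hm.aemeasurable]
  refine lintegral_congr fun k₁ => lintegral_congr fun k₃ => ?_
  rw [finsum_resonant_eq_hterm hset a b hg k₁ k₃]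

end Summit.AtomisticToContinuum.FouriersLaw.Theorems.FGRGap.FoldJetRigidity.Lsc

namespace Summit.AtomisticToContinuum.FouriersLaw.Theorems.FGRGap.FoldJetRigidity

/-- **S4a — LOWER SEMICONTINUITY OF THE BOLTZMANN FORM along a.e.-convergent sequences, given the
branch structure** (registered stub `stub_formLowerSemicontinuous` of line `fold-jet-rigidity`, crux
`EmbeddedDrudeMourre.FGRGap`; any real `a, b`). If `2π`-periodic measurable `F n → f` a.e. on the
cell `(-π, π]` (with `f` periodic measurable), then `q(f) ≤ liminf q(F n)`.
Proof: (1) by the two-root structure of the resonant set, `q(g) = ∫⁻_{(-π,π]²} ¼ w(k₁,h,k₃)·bracket²`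
for every periodic measurable `g` (`Lsc.boltzmannForm_eq_lintegral_prod`); (2) the exceptional set
`N = {F n ↛ f}` is `2πℤ`-invariant and null on `ℝ` (`Lsc.volume_setOf_not_tendsto`), and its four
pull-backs by `p.1`, `p.2`, the partner map `h` and `k₄ = p.1 + h - p.2` are null in `ℝ²` — the last
two because the analytic lifts of `h` and of `k₄` are submersions off the null equal-velocity curve
(`Lsc.volume_setOf_partner_mem`, via `Literature.Analysis.Calculus.exists_nhds_measure_inter_preimage_null`);
so the integrands converge a.e. on `ℝ²` (the weight does not depend on `n`); (3) Fatou's lemma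
(`MeasureTheory.lintegral_liminf_le`) on the square cell. [folklore] -/
theorem stub_formLowerSemicontinuous :
    ∀ ω₂ : ℝ, 0 < ω₂ → ∀ h : ℝ → ℝ → ℝ,
      ((∀ k₁ k₃ : ℝ, h k₁ k₃ ∈ Set.Ioc (-π) π) ∧
        (∀ k₁ k₃ : ℝ, resonanceFn ω₂ k₁ (h k₁ k₃) k₃ = 0) ∧
        (∀ k₁ k₃ : ℝ, h (k₁ + 2 * π) k₃ = h k₁ k₃ ∧ h k₁ (k₃ + 2 * π) = h k₁ k₃) ∧
        (∀ k : ℝ, k ∈ Set.Ioc (-π) π → h k k = k) ∧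
        (∀ k₁ k₃ : ℝ, (∀ n : ℤ, k₃ - k₁ ≠ n * (2 * π)) →
          resonantSet ω₂ k₁ k₃ = {toIocMod Real.two_pi_pos (-π) k₃, h k₁ k₃}) ∧
        (∀ k₁ k₃ : ℝ, (∀ n : ℤ, k₃ - k₁ ≠ n * (2 * π)) →
          (h k₁ k₃ = toIocMod Real.two_pi_pos (-π) k₃ ↔ groupVelocity ω₂ k₃ = groupVelocity ω₂ k₁)) ∧
        (∀ k₁ k₃ : ℝ, groupVelocity ω₂ k₃ ≠ groupVelocity ω₂ k₁ →
          groupVelocity ω₂ (h k₁ k₃) ≠ groupVelocity ω₂ (k₁ + h k₁ k₃ - k₃)) ∧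
        Measurable (Function.uncurry h) ∧
        (∀ k₁ k₃ : ℝ, groupVelocity ω₂ k₃ ≠ groupVelocity ω₂ k₁ →
          ∃ (φ : ℝ × ℝ → ℝ) (U : Set (ℝ × ℝ)), U ∈ 𝓝 (k₁, k₃) ∧ AnalyticOnNhd ℝ φ U ∧
            φ (k₁, k₃) = h k₁ k₃ ∧ (∀ p ∈ U, ∃ n : ℤ, φ p = h p.1 p.2 + n * (2 * π)) ∧
            (∀ p ∈ U, groupVelocity ω₂ p.2 ≠ groupVelocity ω₂ p.1) ∧
            (∀ p ∈ U, HasStrictFDerivAt φ (((groupVelocity ω₂ (p.1 + φ p - p.2) - groupVelocity ω₂ p.1) /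
              (groupVelocity ω₂ (φ p) - groupVelocity ω₂ (p.1 + φ p - p.2))) • ContinuousLinearMap.fst ℝ ℝ ℝ +
            ((groupVelocity ω₂ p.2 - groupVelocity ω₂ (p.1 + φ p - p.2)) /
              (groupVelocity ω₂ (φ p) - groupVelocity ω₂ (p.1 + φ p - p.2))) • ContinuousLinearMap.snd ℝ ℝ ℝ) p))) →
      ∀ a b : ℝ,
        (∀ (F : ℕ → ℝ → ℝ) (f : ℝ → ℝ), (∀ n, Function.Periodic (F n) (2 * π)) →
          (∀ n, Measurable (F n)) → Function.Periodic f (2 * π) → Measurable f →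
          (∀ᵐ k ∂(MeasureTheory.volume.restrict (Set.Ioc (-π) π)),
            Filter.Tendsto (fun n => F n k) Filter.atTop (nhds (f k))) →
          boltzmannForm ω₂ a b f ≤ Filter.liminf (fun n => boltzmannForm ω₂ a b (F n)) Filter.atTop) := by
  intro ω₂ hω h hB a b F f hFper hFmeas hfper hfmeas hae
  obtain ⟨-, -, -, -, hset, -, hjac, hmeasH, hlift⟩ := hB
  -- (2) the exceptional set and its four null pull-backs
  obtain ⟨hNnull, hNinv⟩ := Lsc.volume_setOf_not_tendsto hFper hfper hae
  obtain ⟨h2null, h4null⟩ := Lsc.volume_setOf_partner_mem hω hjac hlift hNnull hNinv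
  obtain ⟨h1null, h3null⟩ := Lsc.volume_setOf_fst_mem_and_snd_mem hNnull
  rw [measure_eq_zero_iff_ae_notMem] at h1null h2null h3null h4null
  -- a.e. convergence of the integrands on `ℝ²`
  have hconv : ∀ᵐ p : ℝ × ℝ, Tendsto (fun n => ENNReal.ofReal (1 / 4) * ENNReal.ofReal
      (collisionWeight ω₂ a b p.1 (h p.1 p.2) p.2 *
        (F n p.1 + F n (h p.1 p.2) - F n p.2 - F n (p.1 + h p.1 p.2 - p.2)) ^ 2)) atTop
      (𝓝 (ENNReal.ofReal (1 / 4) * ENNReal.ofReal (collisionWeight ω₂ a b p.1 (h p.1 p.2) p.2 *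
        (f p.1 + f (h p.1 p.2) - f p.2 - f (p.1 + h p.1 p.2 - p.2)) ^ 2))) := by
    filter_upwards [h1null, h2null, h3null, h4null] with p hp1 hp2 hp3 hp4
    simp only [not_not] at hp1 hp2 hp3 hp4
    refine ENNReal.Tendsto.const_mul (ENNReal.tendsto_ofReal ?_) (Or.inr ENNReal.ofReal_ne_top)
    exact tendsto_const_nhds.mul ((((hp1.add hp2).sub hp3).sub hp4).pow 2)
  -- (1) the form as one integral over the square cell, (3) Fatou
  have hmeas : ∀ n, Measurable fun p : ℝ × ℝ => ENNReal.ofReal (1 / 4) * ENNReal.ofReal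
      (collisionWeight ω₂ a b p.1 (h p.1 p.2) p.2 *
        (F n p.1 + F n (h p.1 p.2) - F n p.2 - F n (p.1 + h p.1 p.2 - p.2)) ^ 2) :=
    fun n => (Lsc.measurable_hterm hmeasH ω₂ a b (hFmeas n)).ennreal_ofReal.const_mul _
  rw [Lsc.boltzmannForm_eq_lintegral_prod hset hmeasH a b hfper hfmeas]
  calc ∫⁻ p in Ioc (-π) π ×ˢ Ioc (-π) π, ENNReal.ofReal (1 / 4) * ENNReal.ofReal
          (collisionWeight ω₂ a b p.1 (h p.1 p.2) p.2 *
            (f p.1 + f (h p.1 p.2) - f p.2 - f (p.1 + h p.1 p.2 - p.2)) ^ 2)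
      = ∫⁻ p in Ioc (-π) π ×ˢ Ioc (-π) π, liminf (fun n => ENNReal.ofReal (1 / 4) * ENNReal.ofReal
          (collisionWeight ω₂ a b p.1 (h p.1 p.2) p.2 *
            (F n p.1 + F n (h p.1 p.2) - F n p.2 - F n (p.1 + h p.1 p.2 - p.2)) ^ 2)) atTop :=
        lintegral_congr_ae ((ae_restrict_of_ae hconv).mono fun p hp => hp.liminf_eq.symm)
    _ ≤ liminf (fun n => ∫⁻ p in Ioc (-π) π ×ˢ Ioc (-π) π, ENNReal.ofReal (1 / 4) * ENNReal.ofReal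
          (collisionWeight ω₂ a b p.1 (h p.1 p.2) p.2 *
            (F n p.1 + F n (h p.1 p.2) - F n p.2 - F n (p.1 + h p.1 p.2 - p.2)) ^ 2)) atTop :=
        lintegral_liminf_le hmeas
    _ = liminf (fun n => boltzmannForm ω₂ a b (F n)) atTop :=
        liminf_congr (Eventually.of_forall fun n =>
          (Lsc.boltzmannForm_eq_lintegral_prod hset hmeasH a b (hFper n) (hFmeas n)).symm)

end Summit.AtomisticToContinuum.FouriersLaw.Theorems.FGRGap.FoldJetRigidity

end
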